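import Literature.AlgebraicGeometry.AbelianSchemes.AbelianSchemeConstSubgroupStableCover
import Literature.AlgebraicGeometry.RelativeSpec.GeometricQuotientFreeTorsorLocal
import Mathlib.AlgebraicGeometry.Morphisms.QuasiFinite
import HarnessLib

/-!
# `A → A⁄K` on `T`-valued points: the kernel is the constant group `K` locally on `T`; finite sets of points of `A⁄K`
# lie in affine opens when those of `A` do

Layer `Literature/AlgebraicGeometry/AbelianSchemes`, namespace `Literature.AlgebraicGeometry.AbelianSchemes.AbelianSchemeOver`
(§0 in `Literature.AlgebraicGeometry.RelativeSpec.ActionOver`).  THEOREMS ONLY (no definition, no named fact, no instance, no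
notation, no `sorry`; net Literature debt 0).

Setting of ★ `AbelianSchemeConstSubgroupQuotient`: `A → S → Y` an abelian scheme (`Y` affine), `K ≤ A(S)` a finite group of
sections acting by translations without fixed geometric points (`hfree`), `ψ : A → A⁄K := ★ quotientMk` (a free affine
geometric quotient, ★ `isGeometricQuotient_quotientActionOver`), `A⁄K = ★ quotientBy u K hcov hG hsm hgc`.

* §0 `ActionOver.exists_stableAffineOpens_le_forall_mem` — for an affine open `U` of a separated `X` (over an affine `Y`) acted
  on by a finite `G`: `⋂_g g⁻¹U` is a `G`-STABLE AFFINE open inside `U` containing EVERY point whose orbit lies in `U` (★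
  `exists_stableAffineOpen_le_of_orbit` re-run with the membership clause exported; [MumfordAV1970] §7 Thm. p. 66, proof).
* §1 **`exists_openCover_eq_section_of_comp_quotientMk_eq_one`** — [MumfordAV1970] §7 Thm. 4 «`K = ker`» on ALL `T`-valued
  points: if `x : T → A` over `S` satisfies `x ≫ ψ = 1`, then LOCALLY ON `T` `x` is (the restriction of) a section `σ ∈ K`
  (the torsor property of the free quotient on `T`-points, ★ `exists_openCover_eq_comp_aut_of_comp_eq`, applied to `x` and the
  unit point); **`comp_quotientMk_eq_one_of_openCover`** — conversely such a locally-constant-in-`K` point is killed by `ψ`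
  (★ `comp_quotientMk_eq_one`, morphisms glue along an open cover); `comp_quotientMk_eq_one_iff_exists_openCover` — the iff.
  (★ `AbelianSchemeConstSubgroupQuotientKernel.comp_quotientMk_eq_one_iff` is the case `T = Spec Ω`.)
* §2 **`exists_isAffineOpen_forall_mem_quotientOver`** — if every finite set of points of `A` lies in an affine open (e.g. `A`
  projective over an affine base), then so does every finite set of points of `A⁄K`: pull the finite set back along the
  FINITE `ψ` (Mathlib `Scheme.Hom.finite_preimage`), put the (stable) preimage in a stable affine open `O` (§0), and use the
  affine chart `O⁄K ↪ A⁄K` of the glued quotient (★ `gluedι`, ★ `preimage_opensRange_gluedι`) — [MumfordAV1970] §7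
  Remark p. 69 («if `X` is quasi-projective then so is `X⁄G`», the part of it the dual-pair descent consumes).

Cell `hodgecm-mathlib` (D-0151), FLOOR 0 programme P1, F-3 (M) child line `Cruxes/HDel/Lines/F3DualAbelianSchemeM`, letter (Mb)
`stub_F3Mb` (its KERNEL clause and its last conjunct).  Count-neutral; HC_CM is proved only modulo the 7 printed citations until
rung 0 closes; nothing here is about HC.

Mathlib searched (pin): `Scheme.Hom.finite_preimage`, `IsFinite` ⇒ `LocallyQuasiFinite`, `isAffineOpen_opensRange`,
`isAffine_of_isAffineHom`, `Scheme.Cover.hom_ext`, `Set.Finite.toFinset` (used); Mathlib has no quotients of schemes by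
finite groups.

## References
* [MumfordAV1970] D. Mumford, *Abelian Varieties* (1970), §7 Thm. p. 66 (proof), Remark p. 69, Thm. 4 (p. 72).
* [SGA1] A. Grothendieck, *SGA 1*, Exp. V Prop. 2.6 (iii), Déf. 2.7.
-/

set_option autoImplicit false

noncomputable section

universe u

open CategoryTheory CategoryTheory.Limits AlgebraicGeometry MonoidalCategory CartesianMonoidalCategory
open scoped MonObj

set_option backward.isDefEq.respectTransparency false

/-! ## §0 A stable affine open containing all points whose orbit lies in a given affine open -/

namespace Literature.AlgebraicGeometry.RelativeSpec.ActionOver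

variable {X Y : Scheme.{u}} {r : X ⟶ Y} {G : Type*} [Group G] [Finite G] (ρ : ActionOver r G)

/-- **`⋂_g g⁻¹U` is a `G`-stable affine open inside the affine open `U` containing every point whose `G`-orbit lies in `U`**
(`X` separated, `Y` affine; the construction of ★ `exists_stableAffineOpen_le_of_orbit` with the membership criterion exported,
so that ONE stable affine open serves a whole finite stable set of points). [cite: MumfordAV1970, §7 Thm. p. 66 (proof)] -/
theorem exists_stableAffineOpens_le_forall_mem [X.IsSeparated] [IsAffine Y] (U : X.Opens) (hU : IsAffineOpen U) :
    ∃ O : ρ.StableAffineOpens, O.1 ≤ U ∧ ∀ x : X, (∀ g : G, (ρ.aut g).hom x ∈ U) → x ∈ O.1 := by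
  classical
  haveI : Fintype G := Fintype.ofFinite G
  let V : G → X.Opens := fun g ↦ (ρ.aut g).hom ⁻¹ᵁ U
  let O : X.Opens := Finset.univ.inf V
  have hmem : ∀ y : X, y ∈ O ↔ ∀ g : G, (ρ.aut g).hom y ∈ U := fun y ↦ by
    rw [← SetLike.mem_coe, TopologicalSpace.Opens.coe_finset_inf, Finset.inf_eq_iInf]
    simp only [Function.comp_apply, Set.iInf_eq_iInter, Set.mem_iInter, SetLike.mem_coe,
      Finset.mem_univ, forall_const]
    rfl
  have hO : ∀ g : G, (ρ.aut g).hom ⁻¹ᵁ O = O := by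
    intro g
    ext y
    change (ρ.aut g).hom y ∈ O ↔ y ∈ O
    rw [hmem, hmem]
    constructor
    · intro H h
      have := H (h * g⁻¹)
      rwa [← Scheme.Hom.comp_apply, ρ.aut_hom_comp_aut_hom', inv_mul_cancel_right] at this
    · intro H h
      rw [← Scheme.Hom.comp_apply, ρ.aut_hom_comp_aut_hom']
      exact H (h * g)
  have hOaff : IsAffineOpen O := by
    have : ∀ (s : Finset G), s.Nonempty → IsAffineOpen (s.inf V) := by
      intro s hs
      induction hs using Finset.Nonempty.cons_induction with
      | singleton a => simpa using hU.preimage_of_isIso (ρ.aut a).hom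
      | cons a s ha hs ih => rw [Finset.cons_eq_insert, Finset.inf_insert]
                             exact (hU.preimage_of_isIso (ρ.aut a).hom).inf ih
    exact this _ ⟨1, Finset.mem_univ _⟩
  haveI : IsAffine (O : Scheme.{u}) := hOaff
  refine ⟨⟨O, hO, inferInstance⟩, ?_, fun x hx => (hmem x).mpr hx⟩
  intro y hy
  have := (hmem y).mp hy 1
  rwa [map_one] at this

end Literature.AlgebraicGeometry.RelativeSpec.ActionOver

namespace Literature.AlgebraicGeometry.AbelianSchemes

namespace AbelianSchemeOver

open Literature.AlgebraicGeometry.RelativeSpec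

variable {S : Scheme.{u}} (A : AbelianSchemeOver S) {Y : Scheme.{u}} (u : S ⟶ Y) (K : Subgroup A.Sections)
  [Finite K] [Y.IsSeparated] [IsSeparated (A.X.hom ≫ u)] [S.IsSeparated]
  (hcov : ∀ x : A.left, ∃ O : (A.translationActionOver u K).StableAffineOpens, x ∈ O.1)
  [LocallyOfFiniteType (A.X.hom ≫ u)] [IsLocallyNoetherian Y]
  (hG : ∃ _ : GrpObj (A.quotientOver u K), IsMonHom (A.quotientMk u K hcov))
  (hsm : Smooth (A.quotientOver u K).hom) (hgc : GeometricallyConnected (A.quotientOver u K).hom)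

/-! ## §1 The kernel of `ψ : A → A⁄K` on `T`-valued points -/

omit [Finite K] [Y.IsSeparated] [IsSeparated (A.X.hom ≫ u)] [S.IsSeparated] [LocallyOfFiniteType (A.X.hom ≫ u)]
  [IsLocallyNoetherian Y] in
/-- The unit point followed by a translation is the constant point at the section: `(1 : T → A) ≫ t_σ = (T → S) ≫ σ` on
underlying schemes. [cite: GortzWedhorn2023, Def./Rem. 27.1 (p. 604)] -/
theorem one_left_comp_translation_left {T : Over S} (σ : A.Sections) :
    (1 : T ⟶ A.X).left ≫ (A.translation σ).left = T.hom ≫ σ.left := by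
  rw [← Over.comp_left, ← MonObj.comp_one (toUnit T), Category.assoc, A.one_comp_translation σ, Over.comp_left,
    Over.toUnit_left]

/-- **`K = ker ψ` on ALL `T`-valued points, the hard half** ([MumfordAV1970] §7 Thm. 4): if an `S`-morphism `x : T → A`
is killed by `ψ : A → A⁄K` (as a point of the group scheme `A⁄K`), then LOCALLY ON `T` it is the restriction of a section
`σ ∈ K`: `x` and the unit point have the same image under the free affine geometric quotient `ψ`, so they differ locally by
an element of `K` (★ `exists_openCover_eq_comp_aut_of_comp_eq`, SGA 1 V 2.6 (iii) on `T`-points).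
[cite: MumfordAV1970, §7 Thm. 4 (p. 72)] [cite: SGA1, Exp. V Prop. 2.6 (iii), Déf. 2.7] -/
theorem exists_openCover_eq_section_of_comp_quotientMk_eq_one [IsAffine Y]
    (hfree : ∀ (Ω : Type u) [Field Ω] [IsAlgClosed Ω] (x : Spec (.of Ω) ⟶ A.left) (σ : K), σ ≠ 1 →
      x ≫ (A.translation (σ : A.Sections)).left ≠ x)
    {T : Over S} (x : T ⟶ A.X)
    (hx : x ≫ (show A.X ⟶ (A.quotientBy u K hcov hG hsm hgc).X from A.quotientMk u K hcov) = 1) :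
    ∃ 𝒱 : Scheme.OpenCover.{u} T.left, ∀ j, ∃ σ : K, 𝒱.f j ≫ x.left = 𝒱.f j ≫ T.hom ≫ (σ : A.Sections).left := by
  haveI : Fintype K := Fintype.ofFinite K
  haveI := A.isMonHom_quotientMk u K hcov hG hsm hgc
  haveI := A.isAffineHom_quotientMk_left u K hcov
  have h1 : (1 : T ⟶ A.X) ≫ (show A.X ⟶ (A.quotientBy u K hcov hG hsm hgc).X from A.quotientMk u K hcov) = 1 :=
    MonObj.one_comp _
  have h2 : (1 : T ⟶ A.X).left ≫ (A.quotientMk u K hcov).left = x.left ≫ (A.quotientMk u K hcov).left := by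
    rw [← Over.comp_left, ← Over.comp_left]
    exact congrArg CommaMorphism.left (h1.trans hx.symm)
  obtain ⟨𝒱, h𝒱⟩ := (A.isGeometricQuotient_quotientActionOver u K hcov).exists_openCover_eq_comp_aut_of_comp_eq
    (A.quotientActionOver_free u K hcov hfree) (1 : T ⟶ A.X).left x.left h2
  refine ⟨𝒱, fun j => ?_⟩
  obtain ⟨σ, hσ⟩ := h𝒱 j
  refine ⟨σ, ?_⟩
  rw [hσ, quotientActionOver_aut_hom, one_left_comp_translation_left]

/-- **`K ⊆ ker ψ` on `T`-valued points, glued**: an `S`-morphism `x : T → A` which is, locally on `T`, the restriction of a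
section in `K` is killed by `ψ` (each `σ ∈ K` is, ★ `comp_quotientMk_eq_one`; morphisms to `A⁄K` glue along the cover).
[cite: MumfordAV1970, §7 Thm. 4 (p. 72)] -/
theorem comp_quotientMk_eq_one_of_openCover {T : Over S} (x : T ⟶ A.X) (𝒱 : Scheme.OpenCover.{u} T.left)
    (h : ∀ j, ∃ σ : K, 𝒱.f j ≫ x.left = 𝒱.f j ≫ T.hom ≫ (σ : A.Sections).left) :
    x ≫ (show A.X ⟶ (A.quotientBy u K hcov hG hsm hgc).X from A.quotientMk u K hcov) = 1 := by
  haveI := A.isMonHom_quotientMk u K hcov hG hsm hgc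
  apply Over.OverMorphism.ext
  refine 𝒱.hom_ext _ _ fun j => ?_
  obtain ⟨σ, hσ⟩ := h j
  have hσ1 : (σ : A.Sections) ≫ (show A.X ⟶ (A.quotientBy u K hcov hG hsm hgc).X from A.quotientMk u K hcov) = 1 :=
    A.comp_quotientMk_eq_one u K hcov hG hsm hgc σ
  rw [Over.comp_left, ← Category.assoc, hσ, Category.assoc, Category.assoc, ← Over.comp_left, hσ1, Hom.one_def, Hom.one_def,
    Over.comp_left, Over.comp_left, Over.toUnit_left, Over.toUnit_left]
  rfl

/-- **`K = ker ψ` on ALL `T`-valued points** ([MumfordAV1970] §7 Thm. 4 «`K = ker f`», the functor-of-points form): an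
`S`-morphism `x : T → A` is killed by `ψ : A → A⁄K` iff it is, locally on `T`, the restriction of a section `σ ∈ K`.
[cite: MumfordAV1970, §7 Thm. 4 (p. 72)] [cite: SGA1, Exp. V Prop. 2.6 (iii)] -/
theorem comp_quotientMk_eq_one_iff_exists_openCover [IsAffine Y]
    (hfree : ∀ (Ω : Type u) [Field Ω] [IsAlgClosed Ω] (x : Spec (.of Ω) ⟶ A.left) (σ : K), σ ≠ 1 →
      x ≫ (A.translation (σ : A.Sections)).left ≠ x)
    {T : Over S} (x : T ⟶ A.X) :
    x ≫ (show A.X ⟶ (A.quotientBy u K hcov hG hsm hgc).X from A.quotientMk u K hcov) = 1 ↔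
      ∃ 𝒱 : Scheme.OpenCover.{u} T.left, ∀ j, ∃ σ : K, 𝒱.f j ≫ x.left = 𝒱.f j ≫ T.hom ≫ (σ : A.Sections).left :=
  ⟨A.exists_openCover_eq_section_of_comp_quotientMk_eq_one u K hcov hG hsm hgc hfree x,
    fun ⟨𝒱, h⟩ => A.comp_quotientMk_eq_one_of_openCover u K hcov hG hsm hgc x 𝒱 h⟩

/-! ## §2 Finite sets of points of `A⁄K` lie in affine opens -/

omit [IsLocallyNoetherian Y] in
include hcov in
/-- **Finite sets of points of `A⁄K` lie in affine opens when those of `A` do** ([MumfordAV1970] §7 Remark p. 69, the part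
consumed downstream): for a finite `F ⊂ A⁄K`, its preimage under the FINITE surjective `ψ` is a finite `K`-stable set of points
of `A` (Mathlib `Scheme.Hom.finite_preimage`), contained in an affine open `U` (`hfin`), hence in the stable affine open
`O = ⋂_σ t_σ⁻¹U` (§0); the chart `O⁄K ↪ A⁄K` of the glued quotient (★ `gluedι`, an open immersion from an affine scheme, ★
`preimage_opensRange_gluedι`: `ψ⁻¹(O⁄K) = O`) is an affine open containing `F`. [cite: MumfordAV1970, §7 Remark p. 69 and Thm. p. 66] -/
theorem exists_isAffineOpen_forall_mem_quotientOver [IsAffine Y]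
    (hfin : ∀ s : Finset A.left, ∃ U : A.left.Opens, IsAffineOpen U ∧ ∀ x ∈ s, x ∈ U)
    (F : Finset (A.quotientOver u K).left) :
    ∃ U : (A.quotientOver u K).left.Opens, IsAffineOpen U ∧ ∀ y ∈ F, y ∈ U := by
  classical
  haveI := A.isFinite_quotientMk_left u K hcov
  haveI := A.isSeparated_left_of_isAffine u
  -- the finite preimage of `F` under `ψ`
  set ψ : A.left ⟶ (A.quotientOver u K).left := (A.quotientMk u K hcov).left with hψ
  have hfinS : (ψ ⁻¹' (F : Set (A.quotientOver u K).left)).Finite := ψ.finite_preimage F.finite_toSet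
  obtain ⟨U, hU, hsU⟩ := hfin hfinS.toFinset
  -- one stable affine open containing the whole (stable) preimage
  obtain ⟨O, -, hO⟩ := (A.translationActionOver u K).exists_stableAffineOpens_le_forall_mem U hU
  have hSO : ∀ x : A.left, ψ x ∈ F → x ∈ O.1 := by
    intro x hx
    refine hO x fun σ => hsU _ (hfinS.mem_toFinset.mpr ?_)
    change ψ ((A.translation (σ : A.Sections)).left x) ∈ (F : Set _)
    rw [← Scheme.Hom.comp_apply, hψ, ← Over.comp_left, A.translation_comp_quotientMk u K hcov σ]
    exact hx
  -- the chart `O⁄K ↪ A⁄K` is an affine open containing `F`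
  haveI : IsAffine ((A.translationActionOver u K).pieceQuot O) :=
    isAffine_of_isAffineHom (((A.translationActionOver u K).restrict O.1 O.2.1).invariants.fromSpec)
  refine ⟨((A.translationActionOver u K).gluedι O).opensRange, isAffineOpen_opensRange _, fun y hy => ?_⟩
  obtain ⟨x, rfl⟩ := A.quotientMk_left_surjective u K hcov y
  have hx : x ∈ (A.quotientMk u K hcov).left ⁻¹ᵁ ((A.translationActionOver u K).gluedι O).opensRange := by
    rw [quotientMk_left, (A.translationActionOver u K).preimage_opensRange_gluedι hcov O]
    exact hSO x hy
  exact hx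

end AbelianSchemeOver

end Literature.AlgebraicGeometry.AbelianSchemes

end
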